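import Literature.MathematicalPhysics.QuantumLattice.PairCorrelations
import HarnessLib

/-!
# The `B₁g` character of `D₄` is multiplicative: discharge of `b1gChar_mul`

Trunk T-QLATTICE, family `hubbard` (companion of
`Literature.MathematicalPhysics.QuantumLattice.PairCorrelations`, which defines the `B₁g`
(`x² - y²`) character `b1gChar : DihedralGroup 4 → ℂ` and states the named fact `b1gChar_mul`;
this file only PROVES — it declares no definition).

## Contents

* `b1gChar_mul_holds : b1gChar_mul`, i.e. `χ_{B₁g}(γ₁ γ₂) = χ_{B₁g}(γ₁) χ_{B₁g}(γ₂)` for all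
  `γ₁ γ₂ : DihedralGroup 4`.

## Proof

`χ_{B₁g}` takes the value `(-1)^{i.val}` on both `r i` and `sr i` (`i : ZMod 4`). With Mathlib's
multiplication table `r i * r j = r (i + j)`, `r i * sr j = sr (j - i)`, `sr i * r j = sr (i + j)`,
`sr i * sr j = r (j - i)` (`DihedralGroup.r_mul_r`, `r_mul_sr`, `sr_mul_r`, `sr_mul_sr`),
multiplicativity reduces to the additivity of the parity of `ZMod 4` values
(`(i + j).val = (i.val + j.val) % 4`, `ZMod.val_add`), which holds because `4` is even; the
subtractive cases follow from `(j - i) + i = j` and `((-1)^{i.val})² = 1`.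

## Sources

The values of `b1gChar` are the row `B₁` of the character table of `D₄`
(`E ↦ 1`, `C₄² ↦ 1`, `2C₄ ↦ -1`, `2C₂ ↦ 1`, `2C₂' ↦ -1`): H. F. Jones, *Groups, Representations
and Physics* (IOP, 1990), p. 68, Problem 4.5. The `B₁g` (`d_{x²-y²}`) channel of the square-lattice
point group `C₄ᵥ ≅ D₄`: D. J. Scalapino, *The case for d_{x²-y²} pairing in the cuprate
superconductors*, Phys. Rep. 250 (1995) 329, §2.
-/

namespace Literature.MathematicalPhysics.QuantumLattice

/-- Parity of `ZMod 4` values is additive because `4` is even: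
`(-1)^{(i+j).val} = (-1)^{i.val} (-1)^{j.val}` (`(i + j).val = (i.val + j.val) % 4`). [folklore] -/
private theorem neg_one_pow_zmod_four_val_add (i j : ZMod 4) :
    (-1 : ℂ) ^ (i + j).val = (-1) ^ i.val * (-1) ^ j.val := by
  rw [ZMod.val_add, ← pow_add]
  conv_rhs => rw [← Nat.div_add_mod (i.val + j.val) 4, pow_add, pow_mul]
  norm_num

/-- Parity of `ZMod 4` values is compatible with subtraction:
`(-1)^{(j-i).val} = (-1)^{i.val} (-1)^{j.val}` (the additive case applied to `(j - i) + i = j`,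
and `((-1)^{i.val})² = 1`). [folklore] -/
private theorem neg_one_pow_zmod_four_val_sub (i j : ZMod 4) :
    (-1 : ℂ) ^ (j - i).val = (-1) ^ i.val * (-1) ^ j.val := by
  have h := neg_one_pow_zmod_four_val_add (j - i) i
  rw [sub_add_cancel] at h
  have hi : (-1 : ℂ) ^ i.val * (-1) ^ i.val = 1 := by
    rw [← pow_add, ← two_mul, pow_mul]; norm_num
  calc (-1 : ℂ) ^ (j - i).val = (-1) ^ (j - i).val * ((-1) ^ i.val * (-1) ^ i.val) := by
        rw [hi, mul_one]
    _ = (-1) ^ i.val * (-1) ^ j.val := by rw [h]; ring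

/-- **Discharge of the named fact `b1gChar_mul`**: the `B₁g` character `χ_{B₁g}` is
multiplicative on `D₄ = DihedralGroup 4` (a one-dimensional character). Case split `r i | sr i`
on both factors, Mathlib's multiplication table of `DihedralGroup`, and parity additivity on
`ZMod 4`. Character values: row `B₁` of the character table of `D₄`, Jones, *Groups,
Representations and Physics* (1990), p. 68, Problem 4.5 [cite: Jones1990, p. 68, Problem 4.5];
the `B₁g` (`x² - y²`) representation of the square-lattice point group, Scalapino, Phys. Rep. 250
(1995) 329, §2. [cite: Scalapino1995, §2] -/
theorem b1gChar_mul_holds : b1gChar_mul := by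
  unfold b1gChar_mul
  rintro (i | i) (j | j)
  · simp only [DihedralGroup.r_mul_r, b1gChar, neg_one_pow_zmod_four_val_add]
  · simp only [DihedralGroup.r_mul_sr, b1gChar, neg_one_pow_zmod_four_val_sub]
  · simp only [DihedralGroup.sr_mul_r, b1gChar, neg_one_pow_zmod_four_val_add]
  · simp only [DihedralGroup.sr_mul_sr, b1gChar, neg_one_pow_zmod_four_val_sub]

end Literature.MathematicalPhysics.QuantumLattice
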